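import Summits.SmoothPoincare4.SmoothPoincare4.Theorems.CylinderEntropyImmortalAreaToFloorCutPiecePointwise
import HarnessLib

/-!
# Route `CylinderEntropy`, item `ImmortalAreaToFloor` (stmt-SmoothPoincare4-17197):
# the cutoff-error terms of the weighted monotonicity for a height-cut piece (module Γ6b of
# `BLUEPRINT-17197-c2.md`, part 2)

For a closed immersed cross-section `f : M⁴ → N ⊂ ℝ⁶` with smooth unit normal `ν` tangent to `N`,
mean curvature `H`, a centre `x₀ ∈ ℝ⁶`, a scale `s > 0`, a near-radius `ρ ≥ 0`, the Gaussian weight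
`G_s = exp(-‖f - x₀‖²/(4s))/(4πs)²` and a height weight `u ∈ C²(ℝ)` with `|u'| ≤ c₁/g`,
`|u''| ≤ c₂/g²`, we bound the three cutoff-error integrals entering the hypothesis of the landed
`weightedTwoScaleMonotonicity` by NEAR/FAR splitting at `‖f - x₀‖ = ρ`:
* `cutoffError_slab_le` — `∫ G_s (u''(1-ν₅²) - H u' ν₅) ≤ (c₂/g²)[(4πs)⁻² T + 4e^{-ρ²/(8s)} ∫ G_{2s}]`
  `+ (c₁/g)[(λ/2) ∫ G_s H² + (2λ)⁻¹ ∫ G_s]` (`T` the tilt `∫_{‖f-x₀‖≤ρ} |ν'|²`, `λ > 0` free);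
* `cutoffError_transport_le` — `-(1/s) ∫ u' G_s (r₅ - ν₅⟨r,ν⟩) ≤ (1/s)(c₁/g)[(4πs)⁻² ρ ((κ/2) T + A/(2κ))`
  `+ 32 √s e^{-1/2} e^{-ρ²/(16s)} ∫ G_{4s}]` (`A` the near mass, `κ > 0` free; `|r₅ - ν₅⟨r,ν⟩| ≤ ‖r‖ |ν'|`);
All tails are by scale doubling (landed `gaussian_tail_pointwise`); no layer-cake is needed.

References: W. K. Allard, Ann. of Math. 95 (1972) §6; K. Ecker, *Regularity Theory for Mean Curvature
Flow* (2004), proof of Prop. 3.17 (localised monotonicity, error terms of the cutoff).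
-/

-- the prescribed namespace `Summit.SmoothPoincare4.SmoothPoincare4.…` repeats `SmoothPoincare4`
set_option linter.dupNamespace false

noncomputable section

open Bundle Set Function Filter MeasureTheory Module
open scoped Manifold ContDiff Topology RealInnerProductSpace BigOperators

namespace Summit.SmoothPoincare4.SmoothPoincare4.Cruxes.CylinderRungTwo.KillingFlux

open Literature.Geometry.Riemannian Literature.Geometry.Riemannian.EuclideanHypersurface
open Literature.Geometry.Lorentzian Literature.Geometry.Lorentzian.PseudoRiemannianMetric
open Summit.SmoothPoincare4.SmoothPoincare4.Theorems.GaussianBounds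

/-! ## The error terms -/

section Terms

variable {M : Type*} [TopologicalSpace M] [ChartedSpace (EuclideanSpace ℝ (Fin 4)) M]
  [IsManifold (𝓡 4) ∞ M] [CompactSpace M] [T2Space M] [MeasurableSpace M] [BorelSpace M]

/-- **The slab terms of the cutoff error** (`u''` and `H u'`).  For a closed immersed cross-section
with smooth unit normal `ν`, a centre `x₀`, `s > 0`, `ρ ≥ 0`, `g > 0`, `λ > 0` and `u ∈ C²(ℝ)` with
`|u'| ≤ c₁/g`, `|u''| ≤ c₂/g²`: if the tilt on the near region is `∫_{‖f-x₀‖ ≤ ρ} |ν'|² ≤ T` then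
`∫ G_s (u''(z₅)(1 - ν₅²) - H u'(z₅) ν₅) ≤ (c₂/g²)((4πs)⁻² T + 4 e^{-ρ²/(8s)} ∫ G_{2s})`
`+ (c₁/g)((λ/2) ∫ G_s H² + (2λ)⁻¹ ∫ G_s)`.
Pointwise: `1 - ν₅² = |ν'|² ∈ [0,1]`, `|ν₅| ≤ 1`, `2|H| ≤ λH² + λ⁻¹`; near `G_s ≤ (4πs)⁻²`; far
`G_s ≤ 4e^{-ρ²/(8s)} G_{2s}` (`gaussian_tail_pointwise`). [cite: Allard1972, §6] -/
theorem cutoffError_slab_le {f νf : M → EuclideanSpace ℝ (Fin 6)}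
    (hf : (euclideanMetric (EuclideanSpace ℝ (Fin 6))).IsSpacelikeImmersion (𝓡 4) f)
    (hν : ContMDiff (𝓡 4) 𝓘(ℝ, EuclideanSpace ℝ (Fin 6)) ∞ νf)
    (hun : (euclideanMetric (EuclideanSpace ℝ (Fin 6))).IsUnitNormal (𝓡 4) f νf 1)
    (x₀ : EuclideanSpace ℝ (Fin 6)) {s ρ g c₁ c₂ lam T : ℝ} (hs : 0 < s) (hρ : 0 ≤ ρ)
    (hlam : 0 < lam) {u : ℝ → ℝ} (hu : ContDiff ℝ 2 u)
    (hu1 : ∀ t, |deriv u t| ≤ c₁ / g) (hu2 : ∀ t, |deriv (deriv u) t| ≤ c₂ / g ^ 2)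
    (hT : ∫ w in f ⁻¹' Metric.closedBall x₀ ρ, (∑ i : Fin 5, νf w (Fin.castSucc i) ^ 2)
      ∂riemannianMeasure ((euclideanMetric (EuclideanSpace ℝ (Fin 6))).inducedRiemannianMetric f
        contMDiff_pullbackBilin_holds hf) ≤ T) :
    ∫ w, (Real.exp (-‖f w - x₀‖ ^ 2 / (4 * s)) / (4 * Real.pi * s) ^ 2) *
        (deriv (deriv u) (f w 5) * (1 - νf w 5 ^ 2)
          - (euclideanMetric (EuclideanSpace ℝ (Fin 6))).meanCurvature f contMDiff_pullbackBilin_holds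
              hf νf w * (deriv u (f w 5) * νf w 5))
      ∂riemannianMeasure ((euclideanMetric (EuclideanSpace ℝ (Fin 6))).inducedRiemannianMetric f
        contMDiff_pullbackBilin_holds hf) ≤
      c₂ / g ^ 2 * ((1 / (4 * Real.pi * s) ^ 2) * T + 4 * Real.exp (-ρ ^ 2 / (8 * s)) *
        ∫ w, Real.exp (-‖f w - x₀‖ ^ 2 / (4 * (2 * s))) / (4 * Real.pi * (2 * s)) ^ 2
          ∂riemannianMeasure ((euclideanMetric (EuclideanSpace ℝ (Fin 6))).inducedRiemannianMetric f
            contMDiff_pullbackBilin_holds hf))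
      + c₁ / g * ((lam / 2) * ∫ w, (Real.exp (-‖f w - x₀‖ ^ 2 / (4 * s)) / (4 * Real.pi * s) ^ 2) *
            (euclideanMetric (EuclideanSpace ℝ (Fin 6))).meanCurvature f contMDiff_pullbackBilin_holds
              hf νf w ^ 2
          ∂riemannianMeasure ((euclideanMetric (EuclideanSpace ℝ (Fin 6))).inducedRiemannianMetric f
            contMDiff_pullbackBilin_holds hf)
        + (1 / (2 * lam)) * ∫ w, Real.exp (-‖f w - x₀‖ ^ 2 / (4 * s)) / (4 * Real.pi * s) ^ 2
          ∂riemannianMeasure ((euclideanMetric (EuclideanSpace ℝ (Fin 6))).inducedRiemannianMetric f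
            contMDiff_pullbackBilin_holds hf)) := by
  set g₁ := (euclideanMetric (EuclideanSpace ℝ (Fin 6))).inducedRiemannianMetric f
    contMDiff_pullbackBilin_holds hf with hg₁
  set μ := riemannianMeasure g₁ with hμ
  set Hm : M → ℝ := fun w => (euclideanMetric (EuclideanSpace ℝ (Fin 6))).meanCurvature f
    contMDiff_pullbackBilin_holds hf νf w with hHm
  set G : M → ℝ := fun w => Real.exp (-‖f w - x₀‖ ^ 2 / (4 * s)) / (4 * Real.pi * s) ^ 2 with hG
  set G2 : M → ℝ := fun w => Real.exp (-‖f w - x₀‖ ^ 2 / (4 * (2 * s))) / (4 * Real.pi * (2 * s)) ^ 2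
    with hG2
  set S : M → ℝ := fun w => ∑ i : Fin 5, νf w (Fin.castSucc i) ^ 2 with hS
  set N : Set M := f ⁻¹' Metric.closedBall x₀ ρ with hN
  have hπ := Real.pi_pos
  have hfc : Continuous f := hf.contMDiff_self.continuous
  have hνc : Continuous νf := hν.continuous
  have hGc : Continuous G := continuous_gaussianWeight_comp hf x₀ s
  have hG2c : Continuous G2 := continuous_gaussianWeight_comp hf x₀ (2 * s)
  have hHc : Continuous Hm := continuous_meanCurvature_euclidean hf hν
  have hSc : Continuous S := by
    refine continuous_finsetSum _ fun i _ => ?_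
    exact ((EuclideanSpace.proj (Fin.castSucc i) :
      EuclideanSpace ℝ (Fin 6) →L[ℝ] ℝ).continuous.comp hνc).pow 2
  have hNm : MeasurableSet N := (Metric.isClosed_closedBall.preimage hfc).measurableSet
  -- unit normal facts
  have hνunit : ∀ w, ‖νf w‖ = 1 := fun w => norm_eq_one_of_isUnitNormal hun w
  have hSid : ∀ w, S w = 1 - νf w 5 ^ 2 := fun w => by
    have h := norm_sq_eq_sum_castSucc_add_sq (νf w)
    rw [hνunit w, one_pow] at h
    simp only [hS]; linarith
  have hS0 : ∀ w, 0 ≤ S w := fun w => Finset.sum_nonneg fun i _ => sq_nonneg _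
  have hS1 : ∀ w, S w ≤ 1 := fun w => by rw [hSid]; nlinarith [sq_nonneg (νf w 5)]
  have hν5 : ∀ w, |νf w 5| ≤ 1 := fun w => by
    have h := hSid w
    have h0 := hS0 w
    rw [abs_le]; constructor <;> nlinarith
  have hG0 : ∀ w, 0 ≤ G w := fun w => gaussianWeight_comp_nonneg f x₀ w
  have hGle : ∀ w, G w ≤ 1 / (4 * Real.pi * s) ^ 2 := fun w => gaussianWeight_comp_le f x₀ hs w
  have hc₁ : 0 ≤ c₁ / g := le_trans (abs_nonneg _) (hu1 0)
  have hc₂ : 0 ≤ c₂ / g ^ 2 := le_trans (abs_nonneg _) (hu2 0)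
  -- pointwise bound of the integrand
  set F : M → ℝ := fun w => G w * (deriv (deriv u) (f w 5) * (1 - νf w 5 ^ 2) - Hm w *
    (deriv u (f w 5) * νf w 5)) with hF
  set B : M → ℝ := fun w => c₂ / g ^ 2 * (G w * S w) + c₁ / g * ((lam / 2) * (G w * Hm w ^ 2) +
    (1 / (2 * lam)) * G w) with hB
  have hFB : ∀ w, F w ≤ B w := by
    intro w
    have h1 : deriv (deriv u) (f w 5) * (1 - νf w 5 ^ 2) ≤ c₂ / g ^ 2 * S w := by
      rw [← hSid]
      calc deriv (deriv u) (f w 5) * S w ≤ |deriv (deriv u) (f w 5)| * S w :=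
            mul_le_mul_of_nonneg_right (le_abs_self _) (hS0 w)
        _ ≤ c₂ / g ^ 2 * S w := mul_le_mul_of_nonneg_right (hu2 _) (hS0 w)
    have h2 : -(Hm w * (deriv u (f w 5) * νf w 5)) ≤ c₁ / g * ((lam / 2) * Hm w ^ 2 + 1 / (2 * lam)) := by
      have ha : |Hm w * (deriv u (f w 5) * νf w 5)| ≤ |Hm w| * (c₁ / g) := by
        rw [abs_mul, abs_mul]
        refine mul_le_mul_of_nonneg_left ?_ (abs_nonneg _)
        calc |deriv u (f w 5)| * |νf w 5| ≤ c₁ / g * 1 :=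
              mul_le_mul (hu1 _) (hν5 w) (abs_nonneg _) hc₁
          _ = c₁ / g := mul_one _
      have hb : |Hm w| ≤ (lam / 2) * Hm w ^ 2 + 1 / (2 * lam) := by
        have := two_mul_abs_le (H := Hm w) hlam
        have hl2 : 1 / (2 * lam) = lam⁻¹ / 2 := by field_simp
        rw [hl2]; linarith
      calc -(Hm w * (deriv u (f w 5) * νf w 5)) ≤ |Hm w * (deriv u (f w 5) * νf w 5)| := neg_le_abs _
        _ ≤ |Hm w| * (c₁ / g) := ha
        _ ≤ ((lam / 2) * Hm w ^ 2 + 1 / (2 * lam)) * (c₁ / g) := mul_le_mul_of_nonneg_right hb hc₁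
        _ = c₁ / g * ((lam / 2) * Hm w ^ 2 + 1 / (2 * lam)) := by ring
    calc F w = G w * (deriv (deriv u) (f w 5) * (1 - νf w 5 ^ 2)) +
          G w * (-(Hm w * (deriv u (f w 5) * νf w 5))) := by simp only [hF]; ring
      _ ≤ G w * (c₂ / g ^ 2 * S w) + G w * (c₁ / g * ((lam / 2) * Hm w ^ 2 + 1 / (2 * lam))) :=
          add_le_add (mul_le_mul_of_nonneg_left h1 (hG0 w)) (mul_le_mul_of_nonneg_left h2 (hG0 w))
      _ = B w := by simp only [hB]; ring
  -- integrability
  have h5c : Continuous fun w => f w 5 :=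
    (EuclideanSpace.proj (5 : Fin 6) : EuclideanSpace ℝ (Fin 6) →L[ℝ] ℝ).continuous.comp hfc
  have hν5c : Continuous fun w => νf w 5 :=
    (EuclideanSpace.proj (5 : Fin 6) : EuclideanSpace ℝ (Fin 6) →L[ℝ] ℝ).continuous.comp hνc
  have hu'c : Continuous (deriv u) := hu.continuous_deriv (by norm_num)
  have hu''c : Continuous (deriv (deriv u)) := by
    have h1 : ContDiff ℝ 1 (deriv u) := hu.deriv'
    exact h1.continuous_deriv le_rfl
  have hFc : Continuous F := hGc.mul (((hu''c.comp h5c).mul (continuous_const.sub (hν5c.pow 2))).sub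
    (hHc.mul ((hu'c.comp h5c).mul hν5c)))
  have hBc : Continuous B := (continuous_const.mul (hGc.mul hSc)).add (continuous_const.mul
    ((continuous_const.mul (hGc.mul (hHc.pow 2))).add (continuous_const.mul hGc)))
  have hFi : Integrable F μ := integrable_of_continuous (h := g₁) hFc
  have hBi : Integrable B μ := integrable_of_continuous (h := g₁) hBc
  have hGSi : Integrable (fun w => G w * S w) μ := integrable_of_continuous (h := g₁) (hGc.mul hSc)
  have hGHi : Integrable (fun w => G w * Hm w ^ 2) μ := integrable_of_continuous (h := g₁) (hGc.mul (hHc.pow 2))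
  have hGi : Integrable G μ := integrable_of_continuous (h := g₁) hGc
  have hG2i : Integrable G2 μ := integrable_of_continuous (h := g₁) hG2c
  have hSi : Integrable S μ := integrable_of_continuous (h := g₁) hSc
  -- `∫ F ≤ ∫ B`
  have hint : ∫ w, F w ∂μ ≤ ∫ w, B w ∂μ := integral_mono hFi hBi hFB
  have hBint : ∫ w, B w ∂μ = c₂ / g ^ 2 * ∫ w, G w * S w ∂μ +
      c₁ / g * ((lam / 2) * ∫ w, G w * Hm w ^ 2 ∂μ + (1 / (2 * lam)) * ∫ w, G w ∂μ) := by
    have i1 : Integrable (fun w => c₂ / g ^ 2 * (G w * S w)) μ := hGSi.const_mul _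
    have i2 : Integrable (fun w => lam / 2 * (G w * Hm w ^ 2)) μ := hGHi.const_mul _
    have i3 : Integrable (fun w => 1 / (2 * lam) * G w) μ := hGi.const_mul _
    have i23 : Integrable (fun w => lam / 2 * (G w * Hm w ^ 2) + 1 / (2 * lam) * G w) μ := i2.add i3
    have i4 : Integrable (fun w => c₁ / g * (lam / 2 * (G w * Hm w ^ 2) + 1 / (2 * lam) * G w)) μ :=
      i23.const_mul _
    simp only [hB]
    rw [integral_add i1 i4, integral_const_mul, integral_const_mul, integral_add i2 i3,
      integral_const_mul, integral_const_mul]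
  -- the tilt integral `∫ G S`, near/far
  have hGS : ∫ w, G w * S w ∂μ ≤ (1 / (4 * Real.pi * s) ^ 2) * T +
      4 * Real.exp (-ρ ^ 2 / (8 * s)) * ∫ w, G2 w ∂μ := by
    have hsplit := integral_add_compl hNm hGSi
    have hnear : ∫ w in N, G w * S w ∂μ ≤ (1 / (4 * Real.pi * s) ^ 2) * T := by
      calc ∫ w in N, G w * S w ∂μ ≤ ∫ w in N, (1 / (4 * Real.pi * s) ^ 2) * S w ∂μ := by
            refine setIntegral_mono_on hGSi.integrableOn (hSi.const_mul _).integrableOn hNm ?_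
            intro w _
            exact mul_le_mul_of_nonneg_right (hGle w) (hS0 w)
        _ = (1 / (4 * Real.pi * s) ^ 2) * ∫ w in N, S w ∂μ := integral_const_mul _ _
        _ ≤ (1 / (4 * Real.pi * s) ^ 2) * T := mul_le_mul_of_nonneg_left hT (by positivity)
    have hfar : ∫ w in Nᶜ, G w * S w ∂μ ≤ 4 * Real.exp (-ρ ^ 2 / (8 * s)) * ∫ w, G2 w ∂μ := by
      have hpt : ∀ w ∈ Nᶜ, G w * S w ≤ 4 * Real.exp (-ρ ^ 2 / (8 * s)) * G2 w := by
        intro w hw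
        have hρw : ρ ≤ ‖f w - x₀‖ := by
          simp only [hN, mem_compl_iff, mem_preimage, Metric.mem_closedBall, dist_eq_norm, not_le] at hw
          exact hw.le
        calc G w * S w ≤ G w * 1 := mul_le_mul_of_nonneg_left (hS1 w) (hG0 w)
          _ = G w := mul_one _
          _ ≤ 4 * Real.exp (-ρ ^ 2 / (8 * s)) * G2 w := gaussian_tail_pointwise hs hρ hρw
      calc ∫ w in Nᶜ, G w * S w ∂μ ≤ ∫ w in Nᶜ, 4 * Real.exp (-ρ ^ 2 / (8 * s)) * G2 w ∂μ :=
            setIntegral_mono_on hGSi.integrableOn (hG2i.const_mul _).integrableOn hNm.compl hpt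
        _ ≤ ∫ w, 4 * Real.exp (-ρ ^ 2 / (8 * s)) * G2 w ∂μ := by
            refine setIntegral_le_integral (hG2i.const_mul _) (Eventually.of_forall fun w => ?_)
            exact mul_nonneg (by positivity) (gaussianWeight_comp_nonneg f x₀ w)
        _ = 4 * Real.exp (-ρ ^ 2 / (8 * s)) * ∫ w, G2 w ∂μ := integral_const_mul _ _
    linarith
  -- assemble
  have hmain : ∫ w, F w ∂μ ≤ c₂ / g ^ 2 * ((1 / (4 * Real.pi * s) ^ 2) * T +
      4 * Real.exp (-ρ ^ 2 / (8 * s)) * ∫ w, G2 w ∂μ) +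
      c₁ / g * ((lam / 2) * ∫ w, G w * Hm w ^ 2 ∂μ + (1 / (2 * lam)) * ∫ w, G w ∂μ) := by
    rw [hBint] at hint
    have := mul_le_mul_of_nonneg_left hGS hc₂
    linarith
  exact hmain

/-- **The transport term of the cutoff error** (`u'` against the radial field).  With the notation of
`cutoffError_slab_le`, `κ > 0`, near mass `μ(‖f - x₀‖ ≤ ρ) ≤ A` and near tilt `≤ T`:
`-(1/s) ∫ u'(z₅) G_s (r₅ - ν₅⟨r,ν⟩) ≤ (1/s)(c₁/g)((4πs)⁻² ρ ((κ/2) T + A/(2κ)) + 32 √s e^{-1/2} e^{-ρ²/(16s)} ∫ G_{4s})`,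
`r = f - x₀`.  Pointwise `|r₅ - ν₅⟨r,ν⟩| ≤ ‖r‖ |ν'|` (`abs_vertical_transport_le`); near `‖r‖ ≤ ρ`,
`2|ν'| ≤ κ|ν'|² + κ⁻¹`; far `‖r‖ G_s ≤ 8√s e^{-1/2} G_{2s} ≤ 32 √s e^{-1/2} e^{-ρ²/(16s)} G_{4s}`
(`mul_gaussian_le_gaussian_double`, `gaussian_tail_pointwise`). [cite: Allard1972, §6] -/
theorem cutoffError_transport_le {f νf : M → EuclideanSpace ℝ (Fin 6)}
    (hf : (euclideanMetric (EuclideanSpace ℝ (Fin 6))).IsSpacelikeImmersion (𝓡 4) f)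
    (hν : ContMDiff (𝓡 4) 𝓘(ℝ, EuclideanSpace ℝ (Fin 6)) ∞ νf)
    (hun : (euclideanMetric (EuclideanSpace ℝ (Fin 6))).IsUnitNormal (𝓡 4) f νf 1)
    (x₀ : EuclideanSpace ℝ (Fin 6)) {s ρ g c₁ κ T A : ℝ} (hs : 0 < s) (hρ : 0 ≤ ρ)
    (hκ : 0 < κ) {u : ℝ → ℝ} (hu : ContDiff ℝ 2 u) (hu1 : ∀ t, |deriv u t| ≤ c₁ / g)
    (hT : ∫ w in f ⁻¹' Metric.closedBall x₀ ρ, (∑ i : Fin 5, νf w (Fin.castSucc i) ^ 2)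
      ∂riemannianMeasure ((euclideanMetric (EuclideanSpace ℝ (Fin 6))).inducedRiemannianMetric f
        contMDiff_pullbackBilin_holds hf) ≤ T)
    (hA : (riemannianMeasure ((euclideanMetric (EuclideanSpace ℝ (Fin 6))).inducedRiemannianMetric f
        contMDiff_pullbackBilin_holds hf)).real (f ⁻¹' Metric.closedBall x₀ ρ) ≤ A) :
    -(1 / s) * ∫ w, deriv u (f w 5) * (Real.exp (-‖f w - x₀‖ ^ 2 / (4 * s)) / (4 * Real.pi * s) ^ 2) *
          ((f w - x₀) 5 - νf w 5 * ⟪f w - x₀, νf w⟫)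
        ∂riemannianMeasure ((euclideanMetric (EuclideanSpace ℝ (Fin 6))).inducedRiemannianMetric f
          contMDiff_pullbackBilin_holds hf) ≤
      (1 / s) * (c₁ / g * ((1 / (4 * Real.pi * s) ^ 2) * ρ * ((κ / 2) * T + A / (2 * κ)) +
        32 * Real.sqrt s * Real.exp (-(1 / 2)) * Real.exp (-ρ ^ 2 / (16 * s)) *
          ∫ w, Real.exp (-‖f w - x₀‖ ^ 2 / (4 * (4 * s))) / (4 * Real.pi * (4 * s)) ^ 2
            ∂riemannianMeasure ((euclideanMetric (EuclideanSpace ℝ (Fin 6))).inducedRiemannianMetric f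
              contMDiff_pullbackBilin_holds hf))) := by
  set g₁ := (euclideanMetric (EuclideanSpace ℝ (Fin 6))).inducedRiemannianMetric f
    contMDiff_pullbackBilin_holds hf with hg₁
  set μ := riemannianMeasure g₁ with hμ
  set G : M → ℝ := fun w => Real.exp (-‖f w - x₀‖ ^ 2 / (4 * s)) / (4 * Real.pi * s) ^ 2 with hG
  set G4 : M → ℝ := fun w => Real.exp (-‖f w - x₀‖ ^ 2 / (4 * (4 * s))) / (4 * Real.pi * (4 * s)) ^ 2
    with hG4
  set S : M → ℝ := fun w => ∑ i : Fin 5, νf w (Fin.castSucc i) ^ 2 with hS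
  set N : Set M := f ⁻¹' Metric.closedBall x₀ ρ with hN
  set Y : M → ℝ := fun w => deriv u (f w 5) * G w * ((f w - x₀) 5 - νf w 5 * ⟪f w - x₀, νf w⟫) with hY
  have hπ := Real.pi_pos
  haveI : IsFiniteMeasure μ := isFiniteMeasure_riemannianMeasure g₁
  have hfc : Continuous f := hf.contMDiff_self.continuous
  have hνc : Continuous νf := hν.continuous
  have hGc : Continuous G := continuous_gaussianWeight_comp hf x₀ s
  have hG4c : Continuous G4 := continuous_gaussianWeight_comp hf x₀ (4 * s)
  have hSc : Continuous S := by
    refine continuous_finsetSum _ fun i _ => ?_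
    exact ((EuclideanSpace.proj (Fin.castSucc i) :
      EuclideanSpace ℝ (Fin 6) →L[ℝ] ℝ).continuous.comp hνc).pow 2
  have hNm : MeasurableSet N := (Metric.isClosed_closedBall.preimage hfc).measurableSet
  have hνunit : ∀ w, ‖νf w‖ = 1 := fun w => norm_eq_one_of_isUnitNormal hun w
  have hS0 : ∀ w, 0 ≤ S w := fun w => Finset.sum_nonneg fun i _ => sq_nonneg _
  have hS1 : ∀ w, S w ≤ 1 := fun w => by
    have h := norm_sq_eq_sum_castSucc_add_sq (νf w)
    rw [hνunit w, one_pow] at h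
    simp only [hS]; nlinarith [sq_nonneg (νf w 5)]
  have hsqrtS1 : ∀ w, Real.sqrt (S w) ≤ 1 := fun w => by
    rw [Real.sqrt_le_one]; exact hS1 w
  have hG0 : ∀ w, 0 ≤ G w := fun w => gaussianWeight_comp_nonneg f x₀ w
  have hGle : ∀ w, G w ≤ 1 / (4 * Real.pi * s) ^ 2 := fun w => gaussianWeight_comp_le f x₀ hs w
  have hc₁ : 0 ≤ c₁ / g := le_trans (abs_nonneg _) (hu1 0)
  -- pointwise: `|Y| ≤ (c₁/g) G ‖r‖ √S`
  have hYabs : ∀ w, |Y w| ≤ c₁ / g * (G w * (‖f w - x₀‖ * Real.sqrt (S w))) := by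
    intro w
    simp only [hY]
    rw [abs_mul, abs_mul, abs_of_nonneg (hG0 w)]
    calc |deriv u (f w 5)| * G w * |(f w - x₀) 5 - νf w 5 * ⟪f w - x₀, νf w⟫|
        ≤ c₁ / g * G w * (‖f w - x₀‖ * Real.sqrt (S w)) := by
          refine mul_le_mul (mul_le_mul_of_nonneg_right (hu1 _) (hG0 w))
            (abs_vertical_transport_le (hνunit w)) (abs_nonneg _) (mul_nonneg hc₁ (hG0 w))
      _ = c₁ / g * (G w * (‖f w - x₀‖ * Real.sqrt (S w))) := by ring
  -- near bound: `G ‖r‖ √S ≤ (4πs)⁻² ρ ((κ/2) S + 1/(2κ))`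
  have hnear_pt : ∀ w ∈ N, G w * (‖f w - x₀‖ * Real.sqrt (S w)) ≤
      (1 / (4 * Real.pi * s) ^ 2) * ρ * ((κ / 2) * S w + 1 / (2 * κ)) := by
    intro w hw
    have hr : ‖f w - x₀‖ ≤ ρ := by
      simpa only [hN, mem_preimage, Metric.mem_closedBall, dist_eq_norm] using hw
    have hsq : Real.sqrt (S w) ≤ (κ / 2) * S w + 1 / (2 * κ) := by
      have := two_mul_sqrt_le (hS0 w) hκ
      have h2 : 1 / (2 * κ) = κ⁻¹ / 2 := by field_simp
      rw [h2]; linarith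
    calc G w * (‖f w - x₀‖ * Real.sqrt (S w))
        ≤ (1 / (4 * Real.pi * s) ^ 2) * (ρ * ((κ / 2) * S w + 1 / (2 * κ))) := by
          refine mul_le_mul (hGle w) (mul_le_mul hr hsq (Real.sqrt_nonneg _) hρ) ?_ (by positivity)
          exact mul_nonneg (norm_nonneg _) (Real.sqrt_nonneg _)
      _ = _ := by ring
  -- far bound: `G ‖r‖ √S ≤ 32 √s e^{-1/2} e^{-ρ²/(16s)} G_{4s}`
  have hfar_pt : ∀ w ∈ Nᶜ, G w * (‖f w - x₀‖ * Real.sqrt (S w)) ≤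
      32 * Real.sqrt s * Real.exp (-(1 / 2)) * Real.exp (-ρ ^ 2 / (16 * s)) * G4 w := by
    intro w hw
    have hρw : ρ ≤ ‖f w - x₀‖ := by
      simp only [hN, mem_compl_iff, mem_preimage, Metric.mem_closedBall, dist_eq_norm, not_le] at hw
      exact hw.le
    have h1 : G w * (‖f w - x₀‖ * Real.sqrt (S w)) ≤ ‖f w - x₀‖ * G w := by
      calc G w * (‖f w - x₀‖ * Real.sqrt (S w)) ≤ G w * (‖f w - x₀‖ * 1) := by
            exact mul_le_mul_of_nonneg_left (mul_le_mul_of_nonneg_left (hsqrtS1 w) (norm_nonneg _)) (hG0 w)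
        _ = ‖f w - x₀‖ * G w := by ring
    have h2 := mul_gaussian_le_gaussian_double ‖f w - x₀‖ hs
    have h2s : 0 < 2 * s := by positivity
    have h3 : Real.exp (-‖f w - x₀‖ ^ 2 / (4 * (2 * s))) / (4 * Real.pi * (2 * s)) ^ 2 ≤
        4 * Real.exp (-ρ ^ 2 / (8 * (2 * s))) * (Real.exp (-‖f w - x₀‖ ^ 2 / (4 * (2 * (2 * s)))) /
          (4 * Real.pi * (2 * (2 * s))) ^ 2) := gaussian_tail_pointwise h2s hρ hρw
    have h4 : Real.exp (-‖f w - x₀‖ ^ 2 / (4 * (2 * (2 * s)))) / (4 * Real.pi * (2 * (2 * s))) ^ 2 = G4 w := by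
      simp only [hG4]; ring_nf
    have h5 : Real.exp (-ρ ^ 2 / (8 * (2 * s))) = Real.exp (-ρ ^ 2 / (16 * s)) := by ring_nf
    rw [h4, h5] at h3
    have hpre : 0 ≤ 8 * Real.sqrt s * Real.exp (-(1 / 2)) := by positivity
    calc G w * (‖f w - x₀‖ * Real.sqrt (S w)) ≤ ‖f w - x₀‖ * G w := h1
      _ ≤ 8 * Real.sqrt s * Real.exp (-(1 / 2)) *
          (Real.exp (-‖f w - x₀‖ ^ 2 / (4 * (2 * s))) / (4 * Real.pi * (2 * s)) ^ 2) := h2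
      _ ≤ 8 * Real.sqrt s * Real.exp (-(1 / 2)) *
          (4 * Real.exp (-ρ ^ 2 / (16 * s)) * G4 w) := mul_le_mul_of_nonneg_left h3 hpre
      _ = _ := by ring
  -- integrability
  have h5c : Continuous fun w => f w 5 :=
    (EuclideanSpace.proj (5 : Fin 6) : EuclideanSpace ℝ (Fin 6) →L[ℝ] ℝ).continuous.comp hfc
  have hν5c : Continuous fun w => νf w 5 :=
    (EuclideanSpace.proj (5 : Fin 6) : EuclideanSpace ℝ (Fin 6) →L[ℝ] ℝ).continuous.comp hνc
  have hr5c : Continuous fun w => (f w - x₀) 5 :=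
    (EuclideanSpace.proj (5 : Fin 6) : EuclideanSpace ℝ (Fin 6) →L[ℝ] ℝ).continuous.comp
      (hfc.sub continuous_const)
  have hbc : Continuous fun w => ⟪f w - x₀, νf w⟫ := (hfc.sub continuous_const).inner hνc
  have hu'c : Continuous (deriv u) := hu.continuous_deriv (by norm_num)
  have hYc : Continuous Y := ((hu'c.comp h5c).mul hGc).mul (hr5c.sub (hν5c.mul hbc))
  have hYi : Integrable Y μ := integrable_of_continuous (h := g₁) hYc
  set P : M → ℝ := fun w => G w * (‖f w - x₀‖ * Real.sqrt (S w)) with hP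
  have hPc : Continuous P := hGc.mul ((hfc.sub continuous_const).norm.mul (hSc.sqrt))
  have hPi : Integrable P μ := integrable_of_continuous (h := g₁) hPc
  have hSi : Integrable S μ := integrable_of_continuous (h := g₁) hSc
  have hG4i : Integrable G4 μ := integrable_of_continuous (h := g₁) hG4c
  -- `|∫ Y| ≤ (c₁/g) ∫ P`
  have hYint : |∫ w, Y w ∂μ| ≤ c₁ / g * ∫ w, P w ∂μ := by
    calc |∫ w, Y w ∂μ| ≤ ∫ w, |Y w| ∂μ := abs_integral_le_integral_abs
      _ ≤ ∫ w, c₁ / g * P w ∂μ := integral_mono hYi.abs (hPi.const_mul _) hYabs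
      _ = c₁ / g * ∫ w, P w ∂μ := integral_const_mul _ _
  -- `∫ P ≤ near + far`
  have hPint : ∫ w, P w ∂μ ≤ (1 / (4 * Real.pi * s) ^ 2) * ρ * ((κ / 2) * T + A / (2 * κ)) +
      32 * Real.sqrt s * Real.exp (-(1 / 2)) * Real.exp (-ρ ^ 2 / (16 * s)) * ∫ w, G4 w ∂μ := by
    have hsplit := integral_add_compl hNm hPi
    have hnear : ∫ w in N, P w ∂μ ≤ (1 / (4 * Real.pi * s) ^ 2) * ρ * ((κ / 2) * T + A / (2 * κ)) := by
      calc ∫ w in N, P w ∂μ ≤ ∫ w in N, (1 / (4 * Real.pi * s) ^ 2) * ρ * ((κ / 2) * S w + 1 / (2 * κ)) ∂μ :=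
            setIntegral_mono_on hPi.integrableOn
              (((hSi.const_mul _).add (integrable_const _)).const_mul _).integrableOn hNm hnear_pt
        _ = (1 / (4 * Real.pi * s) ^ 2) * ρ * ((κ / 2) * ∫ w in N, S w ∂μ + 1 / (2 * κ) * μ.real N) := by
            rw [integral_const_mul, integral_add (hSi.const_mul _).integrableOn (integrable_const _),
              integral_const_mul, setIntegral_const, smul_eq_mul, mul_comm (μ.real N)]
        _ ≤ (1 / (4 * Real.pi * s) ^ 2) * ρ * ((κ / 2) * T + A / (2 * κ)) := by
            refine mul_le_mul_of_nonneg_left ?_ (by positivity)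
            have h1 : (κ / 2) * ∫ w in N, S w ∂μ ≤ (κ / 2) * T := mul_le_mul_of_nonneg_left hT (by positivity)
            have h2 : 1 / (2 * κ) * μ.real N ≤ A / (2 * κ) := by
              rw [div_eq_mul_one_div A, mul_comm A, show 1 / (2 * κ) * μ.real N = 1 / (2 * κ) * μ.real N from rfl]
              exact mul_le_mul_of_nonneg_left hA (by positivity)
            linarith
    have hfar : ∫ w in Nᶜ, P w ∂μ ≤ 32 * Real.sqrt s * Real.exp (-(1 / 2)) * Real.exp (-ρ ^ 2 / (16 * s)) *
        ∫ w, G4 w ∂μ := by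
      calc ∫ w in Nᶜ, P w ∂μ ≤ ∫ w in Nᶜ, 32 * Real.sqrt s * Real.exp (-(1 / 2)) *
            Real.exp (-ρ ^ 2 / (16 * s)) * G4 w ∂μ :=
            setIntegral_mono_on hPi.integrableOn (hG4i.const_mul _).integrableOn hNm.compl hfar_pt
        _ ≤ ∫ w, 32 * Real.sqrt s * Real.exp (-(1 / 2)) * Real.exp (-ρ ^ 2 / (16 * s)) * G4 w ∂μ := by
            refine setIntegral_le_integral (hG4i.const_mul _) (Eventually.of_forall fun w => ?_)
            exact mul_nonneg (by positivity) (gaussianWeight_comp_nonneg f x₀ w)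
        _ = _ := integral_const_mul _ _
    linarith
  -- assemble: `-(1/s) ∫ Y ≤ (1/s) |∫ Y| ≤ ...`
  have hs1 : 0 ≤ 1 / s := by positivity
  calc -(1 / s) * ∫ w, Y w ∂μ ≤ (1 / s) * |∫ w, Y w ∂μ| := by
        have := neg_abs_le (∫ w, Y w ∂μ)
        nlinarith
    _ ≤ (1 / s) * (c₁ / g * ∫ w, P w ∂μ) := mul_le_mul_of_nonneg_left hYint hs1
    _ ≤ _ := by
        refine mul_le_mul_of_nonneg_left (mul_le_mul_of_nonneg_left hPint hc₁) hs1

end Terms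

end Summit.SmoothPoincare4.SmoothPoincare4.Cruxes.CylinderRungTwo.KillingFlux

end
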